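import Summits.ResolutionOfSingularities.ResolutionOfSingularities.Theorems.WallFrames11
import Summits.ResolutionOfSingularities.ResolutionOfSingularities.Theorems.NearCutCompanion3
import Summits.ResolutionOfSingularities.ResolutionOfSingularities.Theorems.NearCutWalls2
import Summits.ResolutionOfSingularities.ResolutionOfSingularities.Theorems.ProximityCutArcLaw
import Summits.ResolutionOfSingularities.ResolutionOfSingularities.Theorems.MaxContactCutBoundaryLedger
import Summits.ResolutionOfSingularities.ResolutionOfSingularities.Theorems.MaxContactCutWallCut
import Summits.ResolutionOfSingularities.ResolutionOfSingularities.Theorems.PlanarGhostDescent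
import Literature.AlgebraicGeometry.Resolution.PointBlowupIFPGiraud
import Literature.AlgebraicGeometry.Resolution.AdicNoetherian
import HarnessLib

/-!
# WallFrames (12/17) — Kollár's wall descent in a polynomial frame; sections: JetTransport (cont.), Terminal, Slots

Verbatim slice of the farm-checked monolith `WallFrames.lean` of cell `decomp-res`, seat `decomp-res-lens-5`, g35
(sha256 7405a21d81d102a4…, monolith lines 2880–3064); one namespace `Summit.ResolutionOfSingularities.ResolutionOfSingularities.Theorems.WallFrames` across the
slices, imports chained.  The monolith's module docstring (laws W1–W7, mechanism, novelty, honest placement) is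
reproduced in slice 1; the main theorem `balancedWallPort_holds : WallCut.BalancedWallPort` (hypothesis-free) and the
host-route corollary `ecBalancedWallPort_holds` (aside item 27368 of route MaxContactCut) are in slice 16/17.
-/

open MvPolynomial Finset
open scoped BigOperators
open Literature.AlgebraicGeometry.Resolution
open Literature.AlgebraicGeometry.Resolution.Hauser2010
open Literature.AlgebraicGeometry.Resolution.PointBlowup
open Literature.AlgebraicGeometry.Resolution.HauserPerlega2024

namespace Summit.ResolutionOfSingularities.ResolutionOfSingularities.Theorems.WallFrames

variable {σ : Type*} [Fintype σ] [DecidableEq σ] {K : Type*} [Field K]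

section JetTransport

omit [Fintype σ] [DecidableEq σ] in
/-- Powers of `z`-free polynomials are `z`-free. [folklore] -/
theorem varFree_pow {z : σ} {P : MvPolynomial σ K} (hP : (∀ μ ∈ P.support, μ z = 0)) (n : ℕ) :
    (∀ μ ∈ (P ^ n).support, μ z = 0) := by
  induction n with
  | zero => rw [pow_zero]; exact varFree_C z 1
  | succ n ih => rw [pow_succ]; exact varFree_mul ih hP

omit [Fintype σ] in
/-- The factor form is determined by its remainder being `z`-free: `h = Q (y_z − ζ) + r`, `r` `z`-free ⇒ `r = h|_{y_z:=ζ}`.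
[folklore] -/
theorem vsubst_eq_of_factor {z : σ} {h Q ζ r : MvPolynomial σ K} (hζ : (∀ μ ∈ ζ.support, μ z = 0))
    (hr : (∀ μ ∈ r.support, μ z = 0)) (hfac : h = Q * (X z - ζ) + r) : vsubst z ζ h = r := by
  rw [hfac, map_add, map_mul, map_sub, vsubst_X_self, vsubst_of_varFree ζ hζ, sub_self, mul_zero, zero_add,
    vsubst_of_varFree ζ hr]

/-- **JET TRANSPORT (lost-wall move).** [new] -/
theorem jet_transport {z j : σ} (hjz : j ≠ z) {b : σ → K} (hb : ∀ i, i ≠ z → b i = 0)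
    {h Q ζ : MvPolynomial σ K} (hζ : (∀ μ ∈ ζ.support, μ z = 0)) (hζ1 : (1 : ℕ∞) ≤ ordZero ζ)
    (hfac : h = Q * (X z - ζ) + vsubst z ζ h) (hQ0 : constantCoeff Q ≠ 0) {D : ℕ} (hD1 : 1 ≤ D)
    (hD : ((D + 1 : ℕ) : ℕ∞) ≤ ordZero (vsubst z ζ h)) (hcentre : eval b (chartTransform 1 j h) = 0) :
    (∀ μ ∈ (chartTransform 1 j ζ - C (b z)).support, μ z = 0) ∧
      (1 : ℕ∞) ≤ ordZero (chartTransform 1 j ζ - C (b z)) ∧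
      b z = coeff (Finsupp.single j 1) ζ ∧
      PointBlowup.translate b (chartTransform 1 j h) =
        PointBlowup.translate b (chartTransform 0 j Q) * (X z - (chartTransform 1 j ζ - C (b z))) +
          vsubst z (chartTransform 1 j ζ - C (b z)) (PointBlowup.translate b (chartTransform 1 j h)) ∧
      constantCoeff (PointBlowup.translate b (chartTransform 0 j Q)) = constantCoeff Q ∧
      ((D : ℕ) : ℕ∞) ≤ ordZero (vsubst z (chartTransform 1 j ζ - C (b z))
        (PointBlowup.translate b (chartTransform 1 j h))) := by
  classical
  set r := vsubst z ζ h with hrdef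
  set ζ' := chartTransform 1 j ζ - C (b z) with hζ'def
  have hr2 : ((2 : ℕ) : ℕ∞) ≤ ordZero r := le_trans (by exact_mod_cast (by omega : 2 ≤ D + 1)) hD
  obtain ⟨hbz, hζ'1⟩ := recentring hjz hb hfac hQ0 hζ hζ1 hr2 hcentre
  have hζ'free : (∀ μ ∈ ζ'.support, μ z = 0) := varFree_transport hjz hζ (b z)
  have hframe := frame_transport hjz hb hfac hζ hζ1 (by omega : 1 ≤ D + 1) hD
  rw [Nat.add_sub_cancel] at hframe
  -- the new remainder is `z`-free
  set r' := X j ^ D * PointBlowup.translate b (chartTransform (D + 1) j r) with hr'def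
  have hrfree : (∀ μ ∈ r.support, μ z = 0) := varFree_vsubst hζ h
  have hr'free : (∀ μ ∈ r'.support, μ z = 0) := by
    refine varFree_mul (varFree_pow (varFree_X_of_ne hjz) D) ?_
    rw [translate_eq_zshear hb, zshear_of_varFree _ (varFree_chartTransform hjz (D + 1) hrfree)]
    exact varFree_chartTransform hjz (D + 1) hrfree
  have hvs : vsubst z ζ' (PointBlowup.translate b (chartTransform 1 j h)) = r' :=
    vsubst_eq_of_factor hζ'free hr'free hframe
  have hunit : constantCoeff (PointBlowup.translate b (chartTransform 0 j Q)) = constantCoeff Q :=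
    constantCoeff_rotation_unit j (hb j hjz) Q
  refine ⟨hζ'free, hζ'1, hbz, ?_, hunit, ?_⟩
  · rw [hvs]; exact hframe
  · rw [hvs, hr'def]
    refine le_trans ?_ (le_ordZero_mul _ _)
    rw [ordZero_X_pow]
    exact le_self_add

omit [Fintype σ] in
/-- **JET ROTATION (free-chart move).**  Frame `h = Q (y_z − ζ) + r` (depth `≥ D+1`), free-chart move in chart `z` with
centre `b = β e_m` off `z`; `h' = translate b (cT_1^z h)`, rotation germ `g = translate b (1 − cT_1^z ζ)`.  If `h'(0) = 0`
(the lineage vanishes at the new point) then: `h' = Q' g + y_z^D (…)` with `Q'(0) = Q(0)`, `g(0) = 0`,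
`coeff_{y_m} h' = Q(0) coeff_{y_m} g`, `coeff_{y_m} g = −coeff_{y_m} ζ`, and EVERY jet `ζ₂` of `g` in the new letter `m` of
depth `D₂` is a jet of `h'` of depth `≥ min (D₂+1) D − 1` — so the new frame `(m, ζ₂)` of `h'` is read off the old jet
(`exists_jet m g`), and the presentation moves by `presentation_freeChart` with the same `ζ₂`. [new] -/
theorem jet_rotation {z m : σ} (hmz : m ≠ z) {b : σ → K} (hb : ∀ i, i ≠ m → b i = 0)
    {h Q ζ : MvPolynomial σ K} (hζ1 : (1 : ℕ∞) ≤ ordZero ζ)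
    (hfac : h = Q * (X z - ζ) + vsubst z ζ h) (hQ0 : constantCoeff Q ≠ 0) {D : ℕ} (hD1 : 1 ≤ D)
    (hD : ((D + 1 : ℕ) : ℕ∞) ≤ ordZero (vsubst z ζ h))
    (h0 : constantCoeff (PointBlowup.translate b (chartTransform 1 z h)) = 0) :
    PointBlowup.translate b (chartTransform 1 z h) =
        PointBlowup.translate b (chartTransform 0 z Q) * PointBlowup.translate b (1 - chartTransform 1 z ζ) +
          X z ^ D * PointBlowup.translate b (chartTransform (D + 1) z (vsubst z ζ h)) ∧
      constantCoeff (PointBlowup.translate b (chartTransform 0 z Q)) = constantCoeff Q ∧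
      constantCoeff (PointBlowup.translate b (1 - chartTransform 1 z ζ)) = 0 ∧
      coeff (Finsupp.single m 1) (PointBlowup.translate b (chartTransform 1 z h)) =
        constantCoeff Q * coeff (Finsupp.single m 1) (PointBlowup.translate b (1 - chartTransform 1 z ζ)) ∧
      coeff (Finsupp.single m 1) (PointBlowup.translate b (1 - chartTransform 1 z ζ)) =
        -coeff (Finsupp.single m 1) ζ ∧
      ∀ ζ₂ : MvPolynomial σ K, (1 : ℕ∞) ≤ ordZero ζ₂ → ∀ D₂ : ℕ,
        ((D₂ + 1 : ℕ) : ℕ∞) ≤ ordZero (vsubst m ζ₂ (PointBlowup.translate b (1 - chartTransform 1 z ζ))) →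
        ((min (D₂ + 1) D : ℕ) : ℕ∞) ≤ ordZero (vsubst m ζ₂ (PointBlowup.translate b (chartTransform 1 z h))) := by
  classical
  have hbz : b z = 0 := hb z hmz.symm
  set r := vsubst z ζ h with hrdef
  set g := PointBlowup.translate b (1 - chartTransform 1 z ζ) with hgdef
  set Q' := PointBlowup.translate b (chartTransform 0 z Q) with hQ'def
  have hrot := rotation_law hbz hfac hζ1 (by omega : 1 ≤ D + 1) hD
  rw [Nat.add_sub_cancel] at hrot
  have hunit : constantCoeff Q' = constantCoeff Q := constantCoeff_rotation_unit z hbz Q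
  set T := PointBlowup.translate b (chartTransform (D + 1) z r) with hTdef
  have hT0 : constantCoeff (X z ^ D * T) = 0 := by
    rw [map_mul, map_pow, constantCoeff_X, zero_pow (by omega : D ≠ 0), zero_mul]
  have hg0 : constantCoeff g = 0 := by
    have := h0
    rw [hrot, map_add, map_mul, hT0, add_zero, hunit] at this
    exact (mul_eq_zero.mp this).resolve_left hQ0
  have hTm : coeff (Finsupp.single m 1) (X z ^ D * T) = 0 := by
    obtain ⟨D', rfl⟩ : ∃ D', D = D' + 1 := ⟨D - 1, by omega⟩
    rw [pow_succ, mul_comm (X z ^ D'), mul_assoc, coeff_X_mul']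
    rw [if_neg]
    rw [Finsupp.mem_support_iff, Finsupp.single_apply, if_neg hmz, ne_eq, not_not]
  have hcoef : coeff (Finsupp.single m 1) (PointBlowup.translate b (chartTransform 1 z h)) =
      constantCoeff Q * coeff (Finsupp.single m 1) g := by
    rw [hrot, coeff_add, coeff_single_one_mul _ _ hg0, hTm, add_zero, hunit]
  refine ⟨hrot, hunit, hg0, hcoef, coeff_single_rotation_germ hmz hbz hζ1, ?_⟩
  intro ζ₂ hζ₂1 D₂ hD₂
  rw [hrot, map_add, map_mul]
  refine le_ordZero_add ?_ ?_
  · refine le_trans ?_ (le_ordZero_mul_left _ _)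
    exact le_trans (by exact_mod_cast Nat.min_le_left _ _) hD₂
  · refine le_trans ?_ (le_ordZero_vsubst hζ₂1 _)
    refine le_trans ?_ (le_ordZero_mul _ _)
    rw [ordZero_X_pow]
    exact le_trans (by exact_mod_cast Nat.min_le_right _ _) le_self_add

end JetTransport

/-! ## §19 THE TERMINAL CONTRADICTION (NEXT-g36 §6 (viii), packaged): an extinct presentation kills isolation

At the horizon `T*` the presentation of `zshear f ζ G` has every near index "in the quadrant" (`s ≤ n_v + n_f`) and a far
part of wall-degree `≥ M + 1 + q`; with `TailInv` (`F = y^r U G + Cq`, `Cq` Hasse-flat below `q`, `q ≤ r_v + s`) the top ideal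
of `F` lies in `(y_v, y_f − ζ) ⊔ (y_u^{M+1})`, which contains no `g·y_u^M` with `g(0) ≠ 0` — contradicting isolation. -/

section Terminal

variable {τ : Type} [Fintype τ] [DecidableEq τ] {L : Type} [Field L] [DecidableEq L]

omit [DecidableEq L] in
/-- **NO ISOLATION AT AN EXTINCT PRESENTATION (K3, terminal form).** [new] -/
theorem no_isolation_of_presentation {u v z : τ} (huv : u ≠ v) (huz : u ≠ z) (hvz : v ≠ z)
    (hσ : ∀ i, i = u ∨ i = v ∨ i = z) {ζ : MvPolynomial τ L} (hζ : (∀ μ ∈ ζ.support, μ z = 0))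
    (hζ1 : (1 : ℕ∞) ≤ ordZero ζ) {q s M : ℕ} {r : τ →₀ ℕ} (hr : q ≤ r v + s) {F G U Cq : MvPolynomial τ L}
    (hF : F = monomial r 1 * U * G + Cq) (hCq : ∀ d : τ →₀ ℕ, d ≠ 0 → d.degree < q → hasseDeriv L d Cq = 0)
    {α : Type*} {A : Finset α} {ι : α → τ →₀ ℕ} {Uα : α → MvPolynomial τ L} {R : MvPolynomial τ L}
    (hpres : zshear z ζ G = ∑ a ∈ A, monomial (ι a) 1 * Uα a + R)
    (hnear : ∀ a ∈ A, s ≤ ι a v + ι a z) (hfar : ∀ d ∈ R.support, (M + 1 + q) + d z ≤ d.degree)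
    {g : MvPolynomial τ L} (hg0 : constantCoeff g ≠ 0) (hiso : g * X u ^ M ∈ TightDefectClasses.topIdeal q F) :
    False := by
  classical
  set Nn := ∑ a ∈ A, monomial (ι a) (1 : L) * Uα a with hNndef
  have hζn : (∀ μ ∈ (-ζ).support, μ z = 0) := varFree_neg hζ
  have hG : G = zshear z (-ζ) Nn + zshear z (-ζ) R := by
    rw [← map_add, ← hpres, zshear_neg_zshear hζ]
  have hback : ∀ P : MvPolynomial τ L, zshear z ζ (zshear z (-ζ) P) = P := fun P => by
    have := zshear_neg_zshear hζn P
    rwa [neg_neg] at this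
  -- near part: in the frame ideal `(y_v, y_z − ζ)^s`
  have hA' : zshear z (-ζ) Nn ∈ Ideal.span {(X v : MvPolynomial τ L), X z - ζ} ^ s := by
    refine mem_span_pair_pow_of_support hvz hζ fun d hd => ?_
    rw [hback] at hd
    obtain ⟨a, ha, hle⟩ := exists_le_of_mem_support_presentation A ι Uα hd
    exact le_trans (hnear a ha) (Nat.add_le_add (hle v) (hle z))
  have hA : monomial r 1 * U * zshear z (-ζ) Nn ∈ Ideal.span {(X v : MvPolynomial τ L), X z - ζ} ^ q := by
    rw [mul_assoc]
    exact monomial_mul_mem_framePow hr (Ideal.mul_mem_left _ _ hA')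
  -- far part: in `(y_u, y_v)^{M+1+q}`, stable under the un-shear
  have hR : R ∈ Ideal.span {(X u : MvPolynomial τ L), X v} ^ (M + 1 + q) := by
    rw [as_sum R]
    refine Ideal.sum_mem _ fun d hd => monomial_mem_span_pair_pow huv ?_ _
    have h1 := hfar d hd
    rw [degree_eq_of_three huv huz hvz hσ d] at h1
    omega
  have hB' : zshear z (-ζ) R ∈ Ideal.span {(X u : MvPolynomial τ L), X v} ^ (M + 1 + q) := by
    have h1 := mem_span_pow_of_zshear_mem (S := {(X u : MvPolynomial τ L), X v}) (n := M + 1 + q)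
      (G := zshear z (-ζ) R) hζ (by rw [hback]; exact hR)
    rwa [Set.image_pair, zshear_X_of_ne huz, zshear_X_of_ne hvz] at h1
  have hB : monomial r 1 * U * zshear z (-ζ) R ∈ Ideal.span {(X u : MvPolynomial τ L), X v} ^ (M + 1 + q) :=
    Ideal.mul_mem_left _ _ hB'
  have hFsum : F = monomial r 1 * U * zshear z (-ζ) Nn + monomial r 1 * U * zshear z (-ζ) R + Cq := by
    rw [hF, hG, mul_add]
  have hle := topIdeal_le_frame_sup_far (u := u) (Λ := M + 1) hA hB hCq
  rw [← hFsum] at hle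
  exact not_mem_frame_sup_far huv huz hvz hζ hζ1 hg0 (Nat.lt_succ_self M) (hle hiso)

end Terminal

/-! ## §20 THE TORIC SHADOW OF THE WALK (NEXT-g36 §1 letters/slots, PROVED): slots, the word, and the switch law

Along a δ-balanced tail the two walls occupy two SLOTS; at each move the new exceptional letter `E = j` takes the slot of
the LOST wall and the kept wall keeps its slot; the toric letter `w τ` records which slot was lost (`true` = slot 1, matching
`ExtinctionCut.step true (x₁,x₂) = (x₁+x₂, x₂)`: the lost slot's coordinate becomes the sum).  `StaysOnNewest` flips the
letter (`lost_of_staysOnNewest`), so recurrence of `StaysOnNewest` gives `ExtinctionCut.both_letters_of_switches`. -/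

section Slots

variable {L : Type} [Field L] [DecidableEq L]

end Slots

end Summit.ResolutionOfSingularities.ResolutionOfSingularities.Theorems.WallFrames
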